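import Mathlib
import HarnessLib

/-!
# The jackknife error of a POOLED RATIO, exactly; for blocks of equal weight it IS the linearised
# (ratio-of-means) error

HONEST FRAMING: exact (Metropolis-corrected) sampling algorithms for lattice gauge theory;
figures of merit are autocorrelation/cost numbers at stated couplings and volumes; no
continuum-physics claim.

Venture `LatticeQCDFlow` (cell pub-lqcd), topic `Exactness`; FANOUT row 13 (`eng-snf`, GEN-25).
NEW WORK of the cell (elementary algebra), Mathlib only; not a published result; no definition;
nothing cited as a fact (Tukey 1958 NAMED ONLY).  Companion of GEN-25 `…ReplicaJackknifeRatioBias`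
(the CORRECTION of the pooled ratio, exactly) and `…ReplicaJackknifeLogError` (the error of
`−log ȳ` vs its linearisation); here the printed ERROR of `reweighted_mean`.

WHY (row 13).  `estimators.reweighted_mean(O, W)` prints
`err² = ((R−1)/R) Σ_r (θ_{(−r)} − θ_{(·)})²` for the pooled ratio `θ = A/B` of block numerator /
denominator sums `a_r`, `b_r` (`θ_{(−r)} = (A − a_r)/(B − b_r)`).  With the residuals
`e_r = a_r − θ b_r` (`Σ_r e_r = 0`) and `θ_{(−r)} − θ = −e_r/(B − b_r)`:

  **`err² = ((R−1)/R)·[Σ_r e_r²/(B − b_r)² − (Σ_r e_r/(B − b_r))²/R]`**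
  (`jackknife_variance_ratio_eq`), and for blocks of EQUAL weight `b_r = B/R`
  **`err² = R·Σ_r e_r² / ((R−1)·B²)`** (`jackknife_variance_ratio_eq_of_equal_weights`) —

exactly the linearised (ratio-of-means, "Fieller") variance that treats the `R` blocks as
exchangeable units.  So for stream blocks of comparable weight the printed bar of
`reweighted_mean` is the textbook propagated bar; weight imbalance enters only through the
factors `B/(R(B − b_r))`.

* `sum_sq_sub_avg_eq` — `Σ_r (x_r − x̄)² = Σ_r x_r² − (Σ_r x_r)²/R`;
* **`jackknife_variance_ratio_eq`**, **`jackknife_variance_ratio_eq_of_equal_weights`**.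

NOT CLAIMED: anything stochastic (coverage of the ratio bar is the staged
`…ReplicaJackknifeRatio`); anything numerical.
-/

namespace Summit.Ventures.LatticeQCDFlow.Exactness.GeneralNCMC

open Finset

section RatioError

variable {ι : Type*} [Fintype ι]

/-- `Σ_r (x_r − (Σx)/R)² = Σ_r x_r² − (Σ_r x_r)²/R` (`R ≥ 1`). -/
theorem sum_sq_sub_avg_eq [Nonempty ι] (x : ι → ℝ) :
    ∑ r, (x r - (∑ s, x s) / Fintype.card ι) ^ 2
      = ∑ r, x r ^ 2 - (∑ r, x r) ^ 2 / Fintype.card ι := by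
  have hR : (Fintype.card ι : ℝ) ≠ 0 := by positivity
  have hexp : ∀ r, (x r - (∑ s, x s) / Fintype.card ι) ^ 2
      = x r ^ 2 - 2 * ((∑ s, x s) / Fintype.card ι) * x r
          + ((∑ s, x s) / Fintype.card ι) ^ 2 := fun r => by ring
  simp_rw [hexp, sum_add_distrib, sum_sub_distrib, ← mul_sum, sum_const, card_univ, nsmul_eq_mul]
  field_simp
  ring

omit [Fintype ι] in
/-- `θ_{(−r)} − θ = −e_r/(B − b_r)` (`θ = A/B`, `B ≠ 0`, `B − b_r ≠ 0`; private restatement of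
the companion file `…RatioBias`'s `looRatio_sub_ratio_eq`, which has no object file yet). -/
private theorem looRatio_sub_ratio_eq' {a b : ι → ℝ} {A B θ : ℝ} (hθ : θ = A / B) (hB0 : B ≠ 0)
    (r : ι) (hBr : B - b r ≠ 0) :
    (A - a r) / (B - b r) - θ = -(a r - θ * b r) / (B - b r) := by
  rw [hθ]
  field_simp
  ring

/-- **The printed `err²` of the pooled ratio, exactly**:
`((R−1)/R) Σ_r (θ_{(−r)} − θ_{(·)})² = ((R−1)/R)·[Σ_r e_r²/(B − b_r)² − (Σ_r e_r/(B − b_r))²/R]`. -/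
theorem jackknife_variance_ratio_eq [Nonempty ι] {a b : ι → ℝ} {A B θ : ℝ} (hθ : θ = A / B)
    (hB0 : B ≠ 0) (hBr : ∀ r, B - b r ≠ 0) :
    ((Fintype.card ι : ℝ) - 1) / Fintype.card ι
        * ∑ r, ((A - a r) / (B - b r) - (∑ s, (A - a s) / (B - b s)) / Fintype.card ι) ^ 2
      = ((Fintype.card ι : ℝ) - 1) / Fintype.card ι
        * (∑ r, (a r - θ * b r) ^ 2 / (B - b r) ^ 2
            - (∑ r, (a r - θ * b r) / (B - b r)) ^ 2 / Fintype.card ι) := by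
  have hR : (Fintype.card ι : ℝ) ≠ 0 := by positivity
  congr 1
  -- centre at `θ`: the replicates are `θ + d_r` with `d_r = −e_r/(B − b_r)`
  have hrep : ∀ r, (A - a r) / (B - b r) = θ + -(a r - θ * b r) / (B - b r) := fun r => by
    have h := looRatio_sub_ratio_eq' (a := a) hθ hB0 r (hBr r)
    linarith
  simp_rw [hrep]
  rw [sum_add_distrib, sum_const, card_univ, nsmul_eq_mul]
  have hshift : ∀ r, θ + -(a r - θ * b r) / (B - b r)
        - ((Fintype.card ι : ℝ) * θ + ∑ s, -(a s - θ * b s) / (B - b s)) / Fintype.card ι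
      = -(a r - θ * b r) / (B - b r)
        - (∑ s, -(a s - θ * b s) / (B - b s)) / Fintype.card ι := fun r => by
    field_simp
    ring
  simp_rw [hshift]
  rw [sum_sq_sub_avg_eq]
  have h1 : ∀ r, (-(a r - θ * b r) / (B - b r)) ^ 2 = (a r - θ * b r) ^ 2 / (B - b r) ^ 2 :=
    fun r => by rw [neg_div, neg_sq, div_pow]
  have h2 : ∑ r, -(a r - θ * b r) / (B - b r) = -∑ r, (a r - θ * b r) / (B - b r) := by
    rw [← sum_neg_distrib]
    exact sum_congr rfl fun r _ => by rw [neg_div]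
  simp_rw [h1]
  rw [h2, neg_sq]

/-- **Equal block weights ⇒ the printed error IS the linearised ratio error**: if every
`b_r = B/R` then `err² = R·Σ_r e_r²/((R−1)·B²)` (`R ≥ 2`, `Σ_r e_r = 0` used). -/
theorem jackknife_variance_ratio_eq_of_equal_weights (hR2 : 2 ≤ Fintype.card ι) {a b : ι → ℝ}
    {A B θ : ℝ} (hA : A = ∑ r, a r) (hB : B = ∑ r, b r) (hθ : θ = A / B) (hB0 : B ≠ 0)
    (hb : ∀ r, b r = B / Fintype.card ι) :
    ((Fintype.card ι : ℝ) - 1) / Fintype.card ι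
        * ∑ r, ((A - a r) / (B - b r) - (∑ s, (A - a s) / (B - b s)) / Fintype.card ι) ^ 2
      = Fintype.card ι * (∑ r, (a r - θ * b r) ^ 2) / (((Fintype.card ι : ℝ) - 1) * B ^ 2) := by
  have hRpos : 0 < Fintype.card ι := by omega
  haveI : Nonempty ι := Fintype.card_pos_iff.mp hRpos
  have hR : (Fintype.card ι : ℝ) ≠ 0 := by positivity
  have hR1 : (Fintype.card ι : ℝ) - 1 ≠ 0 := by
    have : (2 : ℝ) ≤ Fintype.card ι := by exact_mod_cast hR2
    linarith
  -- the common denominator `B − b_r = B (R−1)/R ≠ 0`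
  have hden : ∀ r, B - b r = B * ((Fintype.card ι : ℝ) - 1) / Fintype.card ι := fun r => by
    rw [hb r]
    field_simp
  have hBr : ∀ r, B - b r ≠ 0 := fun r => by
    rw [hden r]
    exact div_ne_zero (mul_ne_zero hB0 hR1) hR
  rw [jackknife_variance_ratio_eq hθ hB0 hBr]
  -- residuals sum to zero
  have hsum0 : ∑ r, (a r - θ * b r) = 0 := by
    rw [sum_sub_distrib, ← mul_sum, ← hA, ← hB, hθ, div_mul_cancel₀ A hB0, sub_self]
  simp_rw [hden]
  rw [← sum_div, ← sum_div, hsum0, zero_div]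
  field_simp
  ring

end RatioError

end Summit.Ventures.LatticeQCDFlow.Exactness.GeneralNCMC
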